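import Mathlib
import Literature.Analysis.FluidPDE.HardSphereCollisionRecord
import Literature.Analysis.FluidPDE.HardSphereCollisionRecordMeasurable
import Literature.Analysis.FluidPDE.HardSpherePreCollisionSigma
import Literature.Analysis.FluidPDE.HardSphereRegularGeometry
import Literature.Analysis.FluidPDE.HardSphereFreeStretch
import Literature.MathematicalPhysics.KineticTheory.CollisionTubePullbackFlight
import Literature.MathematicalPhysics.KineticTheory.HardSphereEuler
import Summits.AtomisticToContinuum.HydrodynamicLimit.Theses.OneFlightGossipEngine
import Summits.AtomisticToContinuum.HydrodynamicLimit.Theorems.OneFlightGossipEngineOneFlightLayeredChaosWindowEvent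
import Summits.AtomisticToContinuum.HydrodynamicLimit.Theorems.OneFlightGossipEngineOneFlightLayeredChaosJunkInvisibility
import Summits.AtomisticToContinuum.HydrodynamicLimit.Theorems.OneFlightGossipEngineOneFlightLayeredChaosCoarsePast
import Summits.AtomisticToContinuum.HydrodynamicLimit.Theorems.JParityClosureParityInBandEnergyTight

/-!
# Skeleton — crux stmt-AtomisticToContinuum-14535 (`OneFlightLayeredChaos`), line `Sketch`, lead cycle 2 (RESHAPED)

Lead prover-line-stmt-AtomisticToContinuum-14535-1, 2026-08-16. Cycle 1 (lead -0) registered line `Sketch` with the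
honest composition `crux ⇐ stub_body_one` (the crux at unit activity, `Disproof.oneFlightLayeredChaos_iff_one`), closed
the two card lemmas (`bayes_tv_defect` p86136, `transverse_offset_eq_zero_iff` p86746) and landed the measurability
chain (p89177 p89239 p89538 p90043 p91121 p92662 p94104). Cycle 2 RESHAPES `stub_body_one` — same composition idea
(crux ⇐ its `a₀ = 1` body), but the body is now split along the one structural fact every card and every analysis of
this crux uses (informal item, design note (3): "d = 3: uniform impact parameter ⟺ ĝ_out uniform on S² given ĝ_in,
constant Jacobian ε²/4, so exact incoming velocities in 𝒢 are harmless"):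

* `stub_record_geometry` (KINEMATICS, closable): on `Φ.good ∩ W` the `n`-th collision record of `i` is a genuine
  contact record — unit impact vector `ω`, unit incoming direction `ĝ⁻`, `⟪ω, ĝ⁻⟫ < 0`, and the outgoing direction is
  the specular image `ĝ⁺ = ĝ⁻ − 2⟪ω, ĝ⁻⟫ ω`.
* `stub_preVel_eq_flightStart_vel` (THE INCOMING VELOCITIES ARE IN 𝒢, closable): on `Φ.good ∩ W` the recorded
  pre-collisional velocities `(v_i⁻, v_j⁻)` of the `n`-th collision ARE the exact velocities of `i` and of its partner
  `j` logged by `coarsePastOf` at the two flight starts (free flights; right-continuity).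
* `stub_isotropy` (3-D ISOTROPY OF HARD-SPHERE SCATTERING, closable, pure measure theory on `S² ⊂ ℝ³`): the
  push-forward of the flux measure `(−⟪ω, g⟫)₊ dω` on the incoming hemisphere under `ω ↦ g − 2⟪ω, g⟫ω` is `¼ ·`
  surface measure (CIP 1994 §3.1 / GST 2013 §2.1: the hard-sphere cross-section in `d = 3` is isotropic).
* `stub_core` (OPEN — the crux's dynamical content, kernel form): given `𝒢`, the conditional law of the impact
  vector `ω` of the `n`-th collision of `i`, restricted to `W`, is the flux law `∝ (−⟪ω, ĝ⁻⟫)₊ dω` of the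
  `𝒢`-measurable incoming direction `ĝ⁻` (read off `coarsePastOf`/`nthPartnerOf`), up to `C σ^p` uniformly over
  `𝒢`-events `E` and measurable sets `S` of pairs `(ĝ⁻, ω)`. Equivalently: the impact parameter is uniform on the
  `ε`-disc given the coarse past. This is EXACTLY what the passing crux-plan cards (comoving-tube-marking ≈
  poisson-shadow-vacancy; slider-coordinates ≈ collision-time-coordinates ≈ articulated-body-gauge, TRIAGE-r1-2) aim at,
  minus the kinematics they all take for granted; its surplus over the one-snapshot variant is the dust-equidistribution
  statement on the long-gap event (lead-0 NOTES §B5).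
* `body_one_of_stubs` (COMPOSITION, proved here): the four stubs give `Body 1 θ₀` (= `Disproof.Body`); `OneFlightLayeredChaos_proof`
  concludes the crux by name via the activity reduction `body_iff_body_one` (copied from `Disproof.lean` §2).

Tree API used by the composition: `measure_inter_congr_of_symmDiff_null`, `exists_measurable_version_of_comap_event`
(p89239), `measurable_coarsePastOf_nthPartnerOf_restrict` (p92662), `localGibbsLaw_compl_good`,
`measurableSet_good_inter_le_ncard_collisionTimesOf` (p89538).
-/

open MeasureTheory Set Filter Function
open scoped ENNReal Topology InnerProductSpace
open Literature.Analysis.FluidPDE Literature.MathematicalPhysics.KineticTheory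

namespace Summit.AtomisticToContinuum.HydrodynamicLimit.Cruxes.OneFlightLayeredChaos.Sketch

noncomputable section

/-- The body of the crux after the profile binders `a₀ θ₀` (ledger signature verbatim; = `Disproof.Body`). [folklore] -/
def Body (a₀ θ₀ : ℝ) : Prop :=
  ∃ C : ℝ, 0 < C ∧ ∃ p : ℝ, 0 < p ∧ ∃ σ₀ : ℝ, 0 < σ₀ ∧ ∀ σ : ℝ, 0 < σ → σ < σ₀ → ∃ ρ : ℝ, σ ≤ ρ ∧ ρ * (Real.sqrt 2 * Real.pi * σ ^ 2) ≤ 1 ∧ ∀ τ : ℝ, 0 < τ → ∀ n : ℕ, ∃ N₀ : ℕ, ∀ N : ℕ, N₀ ≤ N → ∀ Φ : Literature.Analysis.FluidPDE.HardSphereFlow (Literature.Analysis.FluidPDE.Torus.geometry (Fin 3)) (Literature.MathematicalPhysics.KineticTheory.hsDiameter σ N) (N + 1), ∀ (i : Fin (N + 1)) (B : Set Literature.MathematicalPhysics.KineticTheory.V3), MeasurableSet B → let G : Literature.Analysis.FluidPDE.Geometry (Fin 3) Literature.MathematicalPhysics.KineticTheory.T3 := Literature.Analysis.FluidPDE.Torus.geometry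 (Fin 3); let ε : ℝ := Literature.MathematicalPhysics.KineticTheory.hsDiameter σ N; let w : ℝ := τ * ((N + 1 : ℕ) : ℝ) ^ (-(1 / 3 : ℝ)); let q : Literature.MathematicalPhysics.KineticTheory.T3 → (Fin 3 → ℤ) := Literature.Analysis.FluidPDE.Torus.coarseCell (ρ * ((N + 1 : ℕ) : ℝ) ^ (-(1 / 3 : ℝ))); let P : MeasureTheory.Measure (Literature.Analysis.FluidPDE.Config (N + 1) (Fin 3) Literature.MathematicalPhysics.KineticTheory.T3) := Literature.MathematicalPhysics.KineticTheory.localGibbsLaw σ (fun _ => a₀) (fun _ => 0) (fun _ => θ₀) N Φ; let W : Set (Literature.Analysis.FluidPDE.Config (N + 1) (Fin 3) Literature.MathematicalPhysics.KineticTheory.T3) := {z | n + 1 ≤ Set.ncard (Literature.Analysis.FluidPDE.collisionTimesOf G ε (fun t => Φ.flow t z) i ∩ Set.Ioc 0 w)}; let A : Set (Literature.Analysis.FluidPDE.Config (N + 1) (Fin 3) Literature.MathematicalPhysics.KineticTheory.T3) := {z | (Φ.nthRecordOf i n z).outDir ∈ B}; let u : ℝ := (((Literature.MathematicalPhysics.KineticTheory.sphereMeasure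 (E := Literature.MathematicalPhysics.KineticTheory.V3)) Set.univ)⁻¹ * (Literature.MathematicalPhysics.KineticTheory.sphereMeasure (E := Literature.MathematicalPhysics.KineticTheory.V3)) {ω | (ω : Literature.MathematicalPhysics.KineticTheory.V3) ∈ B}).toReal; ∀ E : Set (Literature.Analysis.FluidPDE.Config (N + 1) (Fin 3) Literature.MathematicalPhysics.KineticTheory.T3), MeasurableSet[MeasurableSpace.comap (fun z => (Φ.coarsePastOf q i n z, Φ.nthPartnerOf i n z)) inferInstance] E → |(P (W ∩ A ∩ E)).toReal - u * (P (W ∩ E)).toReal| ≤ C * σ ^ p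

/-- The route decl IS `∀ a₀ θ₀ > 0, Body a₀ θ₀` (syntactic identity). [folklore] -/
theorem oneFlightLayeredChaos_iff :
    Summit.AtomisticToContinuum.HydrodynamicLimit.Theses.OneFlightGossipEngine.OneFlightLayeredChaos ↔
      ∀ a₀ θ₀ : ℝ, 0 < a₀ → 0 < θ₀ → Body a₀ θ₀ := Iff.rfl

/-! ## The crux unfolded and the activity reduction (copied verbatim from the disprover's `Disproof.lean` §0/§2, so that
this file does not import a `Cruxes` module — Theorems files may not — and elaborates whatever the farm's build of it) -/

/-- Tensor powers scale: `(c f)^{⊗n} = c^n f^{⊗n}`. [folklore] -/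
theorem tensorPow_const_mul {d : Type*} [Fintype d] {X : Type*} (c : ℝ) (n : ℕ)
    (f : X × EuclideanSpace ℝ d → ℝ) (w : Config n d X) :
    tensorPow n (fun y => c * f y) w = c ^ n * tensorPow n f w := by
  simp [tensorPow, Finset.prod_mul_distrib, Finset.prod_const]

/-- **The canonical density is invariant under scaling the one-particle profile** by a nonzero
constant (the partition function scales by the same `c^n`). [folklore] -/
theorem canonicalDensity_const_mul {d : Type*} [Fintype d] {X : Type*} [MeasureSpace X]
    (G : Geometry d X) (ε : ℝ) (n : ℕ) (f : X × EuclideanSpace ℝ d → ℝ) {c : ℝ} (hc : c ≠ 0) :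
    canonicalDensity G ε n (fun y => c * f y) = canonicalDensity G ε n f := by
  have hind : (hardSphereDomain G n ε).indicator (tensorPow n fun y => c * f y) =
      fun w => c ^ n * (hardSphereDomain G n ε).indicator (tensorPow n f) w := by
    funext w
    by_cases hw : w ∈ hardSphereDomain G n ε
    · simp [Set.indicator_of_mem hw, tensorPow_const_mul]
    · simp [Set.indicator_of_notMem hw]
  have hZ : canonicalPartition G ε n (fun y => c * f y) = c ^ n * canonicalPartition G ε n f := by
    simp only [canonicalPartition, hind, integral_const_mul]
  funext z
  simp only [canonicalDensity, hZ, hind, mul_inv]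
  have hcn : c ^ n ≠ 0 := pow_ne_zero n hc
  field_simp

/-- A constant activity factors out of the local Gibbs profile. [folklore] -/
theorem localGibbsProfile_const_activity (a₀ : ℝ) (u₀ : T3 → V3) (θ₀ : T3 → ℝ) :
    localGibbsProfile (fun _ => a₀) u₀ θ₀ = fun y => a₀ * localGibbsProfile (fun _ => 1) u₀ θ₀ y := by
  funext y
  simp [localGibbsProfile]

/-- **The activity drops out of the canonical local Gibbs law**: for constant `a₀ ≠ 0`,
`localGibbsLaw σ a₀ u₀ θ₀ N Φ = localGibbsLaw σ 1 u₀ θ₀ N Φ`. [folklore] -/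
theorem localGibbsLaw_const_activity {a₀ : ℝ} (ha : a₀ ≠ 0) (σ : ℝ) (u₀ : T3 → V3) (θ₀ : T3 → ℝ)
    (N : ℕ) (Φ : HardSphereFlow (Torus.geometry (Fin 3)) (hsDiameter σ N) (N + 1)) :
    localGibbsLaw σ (fun _ => a₀) u₀ θ₀ N Φ = localGibbsLaw σ (fun _ => 1) u₀ θ₀ N Φ := by
  rw [localGibbsLaw, localGibbsLaw, localGibbsProfile_const_activity a₀,
    canonicalDensity_const_mul _ _ _ _ ha]

/-- With zero activity the "local Gibbs law" is the zero measure (junk regime `a₀ = 0`). [folklore] -/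
theorem localGibbsLaw_zero_activity (σ : ℝ) (u₀ : T3 → V3) (θ₀ : T3 → ℝ)
    (N : ℕ) (Φ : HardSphereFlow (Torus.geometry (Fin 3)) (hsDiameter σ N) (N + 1)) :
    localGibbsLaw σ (fun _ => 0) u₀ θ₀ N Φ = 0 := by
  rw [localGibbsLaw, particleLaw_eq]
  have : canonicalDensity (Torus.geometry (Fin 3)) (hsDiameter σ N) (N + 1)
      (localGibbsProfile (fun _ => (0 : ℝ)) u₀ θ₀) = fun _ => 0 := by
    funext z
    have htp : tensorPow (N + 1) (localGibbsProfile (fun _ => (0 : ℝ)) u₀ θ₀) = fun _ => 0 := by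
      funext w
      simp [tensorPow, localGibbsProfile]
    simp [canonicalDensity, htp]
  simp [this]

/-- The body of the crux does not see the (nonzero) activity. [folklore] -/
theorem body_iff_body_one {a₀ : ℝ} (ha : a₀ ≠ 0) (θ₀ : ℝ) : Body a₀ θ₀ ↔ Body 1 θ₀ := by
  simp only [Body, localGibbsLaw_const_activity ha]


/-! ## Stub 1 — kinematics of the `n`-th collision record on the good set -/

-- CLOSED (p97332): landed as `Summit.AtomisticToContinuum.HydrodynamicLimit.Theorems.stub_record_geometry`
-- (file Theorems/OneFlightGossipEngineOneFlightLayeredChaosRecordGeometry.lean); proofs inlined so that the skeleton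
-- elaborates independently of the farm's build of that module.

/-- Reflecting a vector `g` across the hyperplane orthogonal to `nvec` preserves its norm:
`‖g - 2 (⟪g, n⟫ / ‖n‖²) n‖ = ‖g‖`. [folklore] -/
theorem norm_sub_two_mul_div_smul {E : Type*} [NormedAddCommGroup E] [InnerProductSpace ℝ E]
    (g nvec : E) : ‖g - (2 * (inner ℝ g nvec / ‖nvec‖ ^ 2)) • nvec‖ = ‖g‖ := by
  by_cases hn : nvec = 0
  · simp [hn]
  have hn' : ‖nvec‖ ^ 2 ≠ 0 := pow_ne_zero 2 (norm_ne_zero_iff.2 hn)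
  have h : ‖g - (2 * (inner ℝ g nvec / ‖nvec‖ ^ 2)) • nvec‖ ^ 2 = ‖g‖ ^ 2 := by
    rw [norm_sub_sq_real, norm_smul, inner_smul_right, mul_pow, Real.norm_eq_abs, sq_abs]
    field_simp
    ring
  exact (sq_eq_sq₀ (norm_nonneg _) (norm_nonneg _)).1 h

/-- **Specular kinematics of one contact.** For a contact normal `nvec` of length `ε > 0` and an
incoming relative velocity `g` (`⟪nvec, g⟫ < 0`), with `ω = ε⁻¹ nvec`, `ĝ = g/‖g‖` and the
outgoing relative velocity `g' = g - 2 (⟪g, nvec⟫/‖nvec‖²) nvec`: `‖ω‖ = 1`, `‖ĝ‖ = 1`,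
`⟪ω, ĝ⟫ < 0` and `g'/‖g'‖ = ĝ - 2 ⟪ω, ĝ⟫ ω`. [folklore] -/
theorem specular_unit_kinematics {E : Type*} [NormedAddCommGroup E] [InnerProductSpace ℝ E]
    {ε : ℝ} (hε : 0 < ε) {nvec g : E} (hn : ‖nvec‖ = ε) (hin : inner ℝ nvec g < 0) :
    ‖ε⁻¹ • nvec‖ = 1 ∧ ‖‖g‖⁻¹ • g‖ = 1 ∧ inner ℝ (ε⁻¹ • nvec) (‖g‖⁻¹ • g) < 0 ∧
      ‖g - (2 * (inner ℝ g nvec / ‖nvec‖ ^ 2)) • nvec‖⁻¹ •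
          (g - (2 * (inner ℝ g nvec / ‖nvec‖ ^ 2)) • nvec) =
        ‖g‖⁻¹ • g - (2 * inner ℝ (ε⁻¹ • nvec) (‖g‖⁻¹ • g)) • (ε⁻¹ • nvec) := by
  have hg : g ≠ 0 := by
    rintro rfl
    rw [inner_zero_right] at hin
    exact lt_irrefl _ hin
  have hgn : ‖g‖ ≠ 0 := norm_ne_zero_iff.2 hg
  have hgpos : 0 < ‖g‖ := norm_pos_iff.2 hg
  refine ⟨?_, ?_, ?_, ?_⟩
  · rw [norm_smul, norm_inv, Real.norm_of_nonneg hε.le, hn, inv_mul_cancel₀ hε.ne']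
  · rw [norm_smul, norm_inv, norm_norm, inv_mul_cancel₀ hgn]
  · rw [real_inner_smul_left, real_inner_smul_right]
    exact mul_neg_of_pos_of_neg (inv_pos.2 hε) (mul_neg_of_pos_of_neg (inv_pos.2 hgpos) hin)
  · rw [norm_sub_two_mul_div_smul, real_inner_smul_left, real_inner_smul_right, hn, smul_sub,
      smul_smul, smul_smul, real_inner_comm g nvec]
    congr 2
    field_simp

/-- **Kinematics of a contact record.** At a contact of the ordered pair `(i, j)` (`‖x_i - x_j‖ = ε`,
`0 < ε`) whose recorded pre-collisional velocities are incoming (`⟪x_i - x_j, v_i⁻ - v_j⁻⟫ < 0`),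
the record `c = ofConfig G ε z t i j` has unit impact vector, unit incoming direction,
`⟪c.impactVec, c.inDir⟫ < 0`, and its outgoing direction is the specular image
`c.outDir = c.inDir - 2 ⟪c.impactVec, c.inDir⟫ c.impactVec`. [folklore] -/
theorem ofConfig_record_geometry {d X : Type*} [Fintype d] {N : ℕ} {G : Geometry d X} {ε : ℝ}
    (hε : 0 < ε) {z : Config N d X} (t : ℝ) {i j : Fin N} (hc : z ∈ contactSet G N ε i j)
    (hin : inner ℝ (G.sepVec (z i).1 (z j).1)
      ((HardSphereCollisionRecord.ofConfig G ε z t i j).preVel.1 -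
        (HardSphereCollisionRecord.ofConfig G ε z t i j).preVel.2) < 0) :
    ‖(HardSphereCollisionRecord.ofConfig G ε z t i j).impactVec‖ = 1 ∧
      ‖(HardSphereCollisionRecord.ofConfig G ε z t i j).inDir‖ = 1 ∧
      inner ℝ (HardSphereCollisionRecord.ofConfig G ε z t i j).impactVec
        (HardSphereCollisionRecord.ofConfig G ε z t i j).inDir < 0 ∧
      (HardSphereCollisionRecord.ofConfig G ε z t i j).outDir =
        (HardSphereCollisionRecord.ofConfig G ε z t i j).inDir -
          (2 * inner ℝ (HardSphereCollisionRecord.ofConfig G ε z t i j).impactVec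
            (HardSphereCollisionRecord.ofConfig G ε z t i j).inDir) •
            (HardSphereCollisionRecord.ofConfig G ε z t i j).impactVec := by
  have hnorm : ‖G.sepVec (z i).1 (z j).1‖ = ε := (mem_contactSet.1 hc).2
  have hpost : (HardSphereCollisionRecord.ofConfig G ε z t i j).postVel.1 -
      (HardSphereCollisionRecord.ofConfig G ε z t i j).postVel.2 =
      ((HardSphereCollisionRecord.ofConfig G ε z t i j).preVel.1 -
        (HardSphereCollisionRecord.ofConfig G ε z t i j).preVel.2) -
        (2 * (inner ℝ ((HardSphereCollisionRecord.ofConfig G ε z t i j).preVel.1 -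
          (HardSphereCollisionRecord.ofConfig G ε z t i j).preVel.2) (G.sepVec (z i).1 (z j).1) /
            ‖G.sepVec (z i).1 (z j).1‖ ^ 2)) • G.sepVec (z i).1 (z j).1 := by
    have hinv : (HardSphereCollisionRecord.ofConfig G ε z t i j).postVel =
        reflectVel (G.sepVec (z i).1 (z j).1) (HardSphereCollisionRecord.ofConfig G ε z t i j).preVel := by
      rw [HardSphereCollisionRecord.ofConfig_preVel, HardSphereCollisionRecord.ofConfig_postVel,
        reflectVel_reflectVel]
    rw [hinv]
    simp only [reflectVel, mul_smul, two_smul]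
    abel
  obtain ⟨h1, h2, h3, h4⟩ := specular_unit_kinematics hε hnorm hin
  refine ⟨h1, h2, h3, ?_⟩
  rw [HardSphereCollisionRecord.outDir, HardSphereCollisionRecord.inDir, hpost,
    HardSphereCollisionRecord.ofConfig_impactVec]
  exact h4

/-- **KINEMATICS STUB.** Along a hard-sphere flow on `𝕋^d` (diameter `0 < ε < 1/2`), on the good set and on the
window event "`i` has at least `n + 1` collisions in `(0, w]`", the `n`-th collision record `c` of `i` is a genuine
contact record: `‖c.impactVec‖ = 1`, `‖c.inDir‖ = 1`, the pair is incoming `⟪c.impactVec, c.inDir⟫ < 0`, and the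
outgoing direction is the specular reflection `c.outDir = c.inDir − 2⟪c.impactVec, c.inDir⟫ • c.impactVec`.
(Route: `HardSphereFlow.le_encard_collisionTimesOf_of_le_ncard` + `IsHardSphereTrajectory.nthCollisionTimeOf_enum_of_encard`
give that `Φ.nthCollisionTimeOf i n z` is a collision time of `i`; `collide_partner`, `swap_mem_contactPairs_iff`,
`Torus.isHardSphereRegular_geometry` give the contact pair `(i, nthPartnerOf)`; then `norm_ofConfig_impactVec`,
`IsHardSphereTrajectory.inner_sepVec_preVel_neg` and the algebra of `reflectVel`.) [folklore] -/
theorem stub_record_geometry {d : Type*} [Fintype d] {N : ℕ} {ε : ℝ} (hε : 0 < ε) (hε2 : ε < 2⁻¹)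
    (Φ : HardSphereFlow (Torus.geometry d) ε N) (i : Fin N) (n : ℕ) (w : ℝ)
    {z : Config N d (UnitAddTorus d)} (hz : z ∈ Φ.good)
    (hW : n + 1 ≤ Set.ncard (collisionTimesOf (Torus.geometry d) ε (fun t => Φ.flow t z) i ∩ Set.Ioc 0 w)) :
    ‖(Φ.nthRecordOf i n z).impactVec‖ = 1 ∧ ‖(Φ.nthRecordOf i n z).inDir‖ = 1 ∧
      inner ℝ (Φ.nthRecordOf i n z).impactVec (Φ.nthRecordOf i n z).inDir < 0 ∧
      (Φ.nthRecordOf i n z).outDir = (Φ.nthRecordOf i n z).inDir -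
        (2 * inner ℝ (Φ.nthRecordOf i n z).impactVec (Φ.nthRecordOf i n z).inDir) •
          (Φ.nthRecordOf i n z).impactVec := by
  have hn := Φ.le_encard_collisionTimesOf_of_le_ncard hW
  have htraj := Φ.isTrajectory z hz
  obtain ⟨hmem, -, -⟩ := htraj.nthCollisionTimeOf_enum_of_encard hn
  have hpart : Participates (Torus.geometry d) ε (Φ.flow (Φ.nthCollisionTimeOf i n z) z) i :=
    (hmem n le_rfl).1
  have hG := Torus.isHardSphereRegular_geometry (d := d) hε2
  have hp : (i, Φ.nthPartnerOf i n z) ∈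
      contactPairs (Torus.geometry d) ε (Φ.flow (Φ.nthCollisionTimeOf i n z) z) := by
    rcases collide_partner hpart with h1 | h2
    · exact h1
    · exact (swap_mem_contactPairs_iff hG (p := (i, Φ.nthPartnerOf i n z))).1 h2
  have hin := htraj.inner_sepVec_preVel_neg (t := Φ.nthCollisionTimeOf i n z) hp
  exact ofConfig_record_geometry hε _ (mem_contactPairs.1 hp).2 hin

/-! ## Stub 2 — the recorded incoming velocities are the flight-start velocities (so `ĝ⁻ ∈ 𝒢`) -/

-- CLOSED (p98700): landed as `Summit.AtomisticToContinuum.HydrodynamicLimit.Theorems.stub_preVel_eq_flightStart_vel`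
-- (file Theorems/OneFlightGossipEngineOneFlightLayeredChaosFlightStartVel.lean); proofs inlined for the same reason.

/-- **Velocities of a particle with no collision in `(a, b)` are constant on `[a, b)`** (hard-sphere trajectory over a
Hausdorff position space with continuous translations): `v_k(t) = v_k(a)` for `t ∈ [a, b)`. [folklore] -/
theorem vel_eq_of_forall_not_participates {d : Type*} [Fintype d] {X : Type*} [TopologicalSpace X] [T2Space X]
    {N : ℕ} {G : Geometry d X} {ε : ℝ} {γ : ℝ → Config N d X} (h : IsHardSphereTrajectory G ε N γ)
    (hG : ∀ x : X, Continuous (G.translate x)) (k : Fin N) {a b : ℝ}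
    (hk : ∀ u ∈ Ioo a b, ¬ Participates G ε (γ u) k) {t : ℝ} (ht : t ∈ Ico a b) :
    (γ t k).2 = (γ a k).2 := by
  rw [Literature.MathematicalPhysics.KineticTheory.apply_eq_translate_of_forall_not_participates h hG k ht.1
    fun u hu => hk u ⟨hu.1, hu.2.trans_lt ht.2⟩]

/-- **The left-limit velocity at `b` of a particle with no collision in `(a, b)` is its velocity at `a`** (`a < b`;
hard-sphere trajectory over a Hausdorff position space with continuous translations). The particle may well collide
at time `b` itself: only the open interval matters for the left limit. [folklore] -/
theorem leftLim_vel_eq_of_forall_not_participates {d : Type*} [Fintype d] {X : Type*} [TopologicalSpace X]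
    [T2Space X] {N : ℕ} {G : Geometry d X} {ε : ℝ} {γ : ℝ → Config N d X} (h : IsHardSphereTrajectory G ε N γ)
    (hG : ∀ x : X, Continuous (G.translate x)) (k : Fin N) {a b : ℝ} (hab : a < b)
    (hk : ∀ u ∈ Ioo a b, ¬ Participates G ε (γ u) k) :
    (Function.leftLim γ b k).2 = (γ a k).2 := by
  have hev : Continuous fun ζ : Config N d X => (ζ k).2 := (continuous_apply k).snd
  have h1 : Tendsto (fun u => (γ u k).2) (𝓝[<] b) (𝓝 (Function.leftLim γ b k).2) :=
    (hev.tendsto _).comp (h.tendsto_leftLim hG b)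
  have h2 : Tendsto (fun u => (γ u k).2) (𝓝[<] b) (𝓝 (γ a k).2) := by
    refine tendsto_const_nhds.congr' ?_
    filter_upwards [Ioo_mem_nhdsLT hab] with u hu
    rw [vel_eq_of_forall_not_participates h hG k hk ⟨hu.1.le, hu.2⟩]
  exact tendsto_nhds_unique h1 h2

/-- **INCOMING-VELOCITIES-IN-𝒢 STUB.** Along a hard-sphere flow on `𝕋^d` (`0 < ε < 1/2`), on the good set and on the
window event, the pre-collisional velocities recorded at the `n`-th collision of `i` (partner `j = Φ.nthPartnerOf i n z`)
are the velocities of `i`, resp. `j`, in the configurations logged by the coarse past at the two flight starts: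
`c.preVel = (v_i(s_i), v_j(s_j))` with `s_k = flightStart … k t_n` — the flights are free (`not_participates_of_mem_Ioo_flightStart`),
velocities of a non-participating particle do not change (`free` + `collidePair_apply_of_ne` between/at the finitely many
collision times), the trajectory is right-continuous and `c.preVel` is the left limit at `t_n`
(`IsHardSphereTrajectory.ofConfig_preVel_eq_leftLim`). The coarse map `q` is arbitrary (velocities are kept exact by
`coarseConfig`). [folklore] -/
theorem stub_preVel_eq_flightStart_vel {d : Type*} [Fintype d] {N : ℕ} {ε : ℝ} (hε : 0 < ε) (hε2 : ε < 2⁻¹)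
    (Φ : HardSphereFlow (Torus.geometry d) ε N) {C : Type*} (q : UnitAddTorus d → C) (i : Fin N) (n : ℕ) (w : ℝ)
    {z : Config N d (UnitAddTorus d)} (hz : z ∈ Φ.good)
    (hW : n + 1 ≤ Set.ncard (collisionTimesOf (Torus.geometry d) ε (fun t => Φ.flow t z) i ∩ Set.Ioc 0 w)) :
    (Φ.nthRecordOf i n z).preVel =
      (((Φ.coarsePastOf q i n z).1 i).2, ((Φ.coarsePastOf q i n z).2 (Φ.nthPartnerOf i n z)).2) := by
  have _ := hε -- the positivity of `ε` (part of the registered signature) is not needed here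
  have hn := Φ.le_encard_collisionTimesOf_of_le_ncard hW
  have htraj := Φ.isTrajectory z hz
  obtain ⟨hmem, -, -⟩ := htraj.nthCollisionTimeOf_enum_of_encard hn
  have hpart : Participates (Torus.geometry d) ε (Φ.flow (Φ.nthCollisionTimeOf i n z) z) i :=
    (hmem n le_rfl).1
  have hT0 : 0 < Φ.nthCollisionTimeOf i n z := (hmem n le_rfl).2.1
  have hG := Torus.isHardSphereRegular_geometry (d := d) hε2
  have hp : (i, Φ.nthPartnerOf i n z) ∈
      contactPairs (Torus.geometry d) ε (Φ.flow (Φ.nthCollisionTimeOf i n z) z) := by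
    rcases collide_partner hpart with h1 | h2
    · exact h1
    · exact (swap_mem_contactPairs_iff hG (p := (i, Φ.nthPartnerOf i n z))).1 h2
  have hpre := htraj.ofConfig_preVel_eq_leftLim (t := Φ.nthCollisionTimeOf i n z) hp
  rw [HardSphereFlow.nthRecordOf, hpre]
  simp only [HardSphereFlow.coarsePastOf, coarseConfig_apply]
  rw [leftLim_vel_eq_of_forall_not_participates htraj Torus.continuous_geometry_translate i
      (flightStart_lt (htraj.finite_collisionTimesOf_inter_Ioo i 0 _) hT0)
      fun u hu => htraj.not_participates_of_mem_Ioo_flightStart hu,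
    leftLim_vel_eq_of_forall_not_participates htraj Torus.continuous_geometry_translate (Φ.nthPartnerOf i n z)
      (flightStart_lt (htraj.finite_collisionTimesOf_inter_Ioo _ 0 _) hT0)
      fun u hu => htraj.not_participates_of_mem_Ioo_flightStart hu]

/-! ## Stub 3 — 3-D isotropy of hard-sphere scattering -/

-- CLOSED (p101251 submitted; dry-run ACCEPT): `Summit.AtomisticToContinuum.HydrodynamicLimit.Theorems.stub_isotropy`
-- (file Theorems/OneFlightGossipEngineOneFlightLayeredChaosIsotropy.lean, worker a74013833f8ecf426); proofs inlined for the same reason.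

/-! ## The radial extension `Ψ_g(x) = |x|² g − 2⟪x, g⟫ x` of the specular map -/

/-- Jacobian determinant of the radial extension `Ψ_g(x) = |x|² g − 2⟪x, g⟫ x` of the specular map:
`det DΨ_g(x) = −8 ⟪x, g⟫ |x|²` for a unit vector `g ∈ ℝ³`. [folklore] -/
theorem det_fderiv_specularExtension (g x : V3) (hg : ‖g‖ = 1) :
    ((2 : ℝ) • (innerSL ℝ x).smulRight g - (2 : ℝ) • (innerSL ℝ g).smulRight x
      - (2 * ⟪x, g⟫_ℝ) • ContinuousLinearMap.id ℝ V3).det = -8 * ⟪x, g⟫_ℝ * ‖x‖ ^ 2 := by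
  have hg' : ⟪g, g⟫_ℝ = 1 := by rw [real_inner_self_eq_norm_sq, hg]; norm_num
  rw [← real_inner_self_eq_norm_sq]
  rw [ContinuousLinearMap.det, ← LinearMap.det_toMatrix (EuclideanSpace.basisFun (Fin 3) ℝ).toBasis,
    Matrix.det_fin_three]
  simp only [LinearMap.toMatrix_apply, OrthonormalBasis.coe_toBasis,
    OrthonormalBasis.coe_toBasis_repr_apply, EuclideanSpace.basisFun_repr,
    EuclideanSpace.basisFun_apply, ContinuousLinearMap.coe_coe, sub_apply, smul_apply,
    ContinuousLinearMap.smulRight_apply, innerSL_apply_apply, ContinuousLinearMap.id_apply,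
    PiLp.sub_apply, PiLp.smul_apply, smul_eq_mul, EuclideanSpace.inner_single_right,
    PiLp.single_apply]
  simp only [PiLp.inner_apply, Fin.sum_univ_three, RCLike.inner_apply, conj_trivial] at hg' ⊢
  simp only [Fin.isValue, Fin.reduceEq, ↓reduceIte] at hg' ⊢
  linear_combination (-8 * (g.ofLp 0 * x.ofLp 0 + g.ofLp 1 * x.ofLp 1 + g.ofLp 2 * x.ofLp 2) *
      (x.ofLp 0 * x.ofLp 0 + x.ofLp 1 * x.ofLp 1 + x.ofLp 2 * x.ofLp 2)) * hg'

/-- The radial extension `Ψ_g(x) = |x|² g − 2⟪x, g⟫ x` of the specular map is differentiable, with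
`DΨ_g(x) h = 2⟪x, h⟫ g − 2⟪h, g⟫ x − 2⟪x, g⟫ h`. [folklore] -/
theorem hasFDerivAt_specularExtension (g x : V3) :
    HasFDerivAt (fun y : V3 => (‖y‖ ^ 2) • g - (2 * ⟪y, g⟫_ℝ) • y)
      ((2 : ℝ) • (innerSL ℝ x).smulRight g - (2 : ℝ) • (innerSL ℝ g).smulRight x
        - (2 * ⟪x, g⟫_ℝ) • ContinuousLinearMap.id ℝ V3) x := by
  have h1 : HasFDerivAt (fun y : V3 => (‖y‖ ^ 2) • g) ((2 • innerSL ℝ x).smulRight g) x :=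
    (hasStrictFDerivAt_norm_sq x).hasFDerivAt.smul_const g
  have h2 : HasFDerivAt (fun y : V3 => 2 * ⟪y, g⟫_ℝ) ((2 : ℝ) • innerSL ℝ g) x := by
    have h : HasFDerivAt (fun y : V3 => ⟪y, g⟫_ℝ) (innerSL ℝ g) x := by
      have heq : (fun y : V3 => ⟪y, g⟫_ℝ) = innerSL ℝ g := by
        funext y
        rw [innerSL_apply_apply, real_inner_comm]
      rw [heq]
      exact (innerSL ℝ g).hasFDerivAt
    exact h.const_mul 2
  have h3 := h2.smul (hasFDerivAt_id x)
  refine (h1.sub h3).congr_fderiv ?_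
  ext h i
  simp only [sub_apply, smul_apply, ContinuousLinearMap.smulRight_apply, innerSL_apply_apply,
    ContinuousLinearMap.id_apply, add_apply, PiLp.sub_apply, PiLp.smul_apply,
    PiLp.add_apply, smul_eq_mul, nsmul_eq_mul, Nat.cast_ofNat, id_eq]
  ring

/-- `|Ψ_g(x)| = |x|²` for a unit vector `g`. [folklore] -/
theorem norm_specularExtension (g x : V3) (hg : ‖g‖ = 1) :
    ‖(‖x‖ ^ 2) • g - (2 * ⟪x, g⟫_ℝ) • x‖ = ‖x‖ ^ 2 := by
  have h : ‖(‖x‖ ^ 2) • g - (2 * ⟪x, g⟫_ℝ) • x‖ ^ 2 = (‖x‖ ^ 2) ^ 2 := by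
    rw [norm_sub_sq_real, norm_smul, norm_smul, real_inner_smul_left, real_inner_smul_right, hg,
      real_inner_comm g x, Real.norm_eq_abs, Real.norm_eq_abs, mul_pow, mul_pow, sq_abs, sq_abs]
    ring
  exact (pow_left_inj₀ (norm_nonneg _) (by positivity) two_ne_zero).1 h

/-- `Ψ_g` is injective on the open half-space `{⟪x, g⟫ < 0}`. [folklore] -/
theorem injOn_specularExtension (g : V3) (hg : ‖g‖ = 1) :
    InjOn (fun y : V3 => (‖y‖ ^ 2) • g - (2 * ⟪y, g⟫_ℝ) • y) {x | ⟪x, g⟫_ℝ < 0} := by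
  intro x hx y hy hxy
  simp only [mem_setOf_eq] at hx hy hxy
  have hn : ‖x‖ ^ 2 = ‖y‖ ^ 2 := by
    rw [← norm_specularExtension g x hg, ← norm_specularExtension g y hg, hxy]
  rw [hn, sub_right_inj] at hxy
  have h3 : 2 * ⟪x, g⟫_ℝ * ⟪x, g⟫_ℝ = 2 * ⟪y, g⟫_ℝ * ⟪y, g⟫_ℝ := by
    have := congrArg (fun z => ⟪z, g⟫_ℝ) hxy
    simpa only [real_inner_smul_left] using this
  have h4 : ⟪x, g⟫_ℝ = ⟪y, g⟫_ℝ := by nlinarith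
  rw [h4] at hxy
  exact smul_right_injective V3 (by nlinarith : 2 * ⟪y, g⟫_ℝ ≠ 0) hxy

/-- Every vector off the line `ℝ g` is a value `Ψ_g(x)` with `⟪x, g⟫ < 0`. [folklore] -/
theorem mem_image_specularExtension (g : V3) (hg : ‖g‖ = 1) {y : V3} (hy : y ∉ (ℝ ∙ g)) :
    y ∈ (fun x : V3 => (‖x‖ ^ 2) • g - (2 * ⟪x, g⟫_ℝ) • x) '' {x | ⟪x, g⟫_ℝ < 0} := by
  have hy0 : y ≠ 0 := fun h => hy (h ▸ Submodule.zero_mem _)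
  have hr0 : 0 < ‖y‖ := norm_pos_iff.2 hy0
  set yh : V3 := ‖y‖⁻¹ • y with hyh
  have hyh1 : ‖yh‖ = 1 := by
    rw [hyh, norm_smul, norm_inv, norm_norm, inv_mul_cancel₀ hr0.ne']
  have hne : yh ≠ g := by
    intro h
    apply hy
    rw [Submodule.mem_span_singleton]
    exact ⟨‖y‖, by rw [← h, hyh, smul_smul, mul_inv_cancel₀ hr0.ne', one_smul]⟩
  set u : V3 := g - yh with hu
  have hug : ⟪u, g⟫_ℝ = 1 - ⟪yh, g⟫_ℝ := by
    rw [hu, inner_sub_left, real_inner_self_eq_norm_sq, hg]; ring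
  have hlt : ⟪yh, g⟫_ℝ < 1 := (inner_lt_one_iff_real_of_norm_eq_one hyh1 hg).2 hne
  have hug0 : 0 < ⟪u, g⟫_ℝ := by linarith
  have hu2 : ‖u‖ ^ 2 = 2 * ⟪u, g⟫_ℝ := by
    rw [hu, norm_sub_sq_real, hg, hyh1, inner_sub_left, real_inner_self_eq_norm_sq, hg,
      real_inner_comm]
    ring
  have hu0 : 0 < ‖u‖ := norm_pos_iff.2 (sub_ne_zero.2 hne.symm)
  set c : ℝ := -(Real.sqrt ‖y‖ * ‖u‖⁻¹) with hc
  have hc2 : c ^ 2 * ‖u‖ ^ 2 = ‖y‖ := by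
    rw [hc, neg_sq, mul_pow, Real.sq_sqrt hr0.le, inv_pow, mul_assoc,
      inv_mul_cancel₀ (by positivity), mul_one]
  have hc0 : c < 0 := by rw [hc]; exact neg_neg_of_pos (by positivity)
  refine ⟨c • u, ?_, ?_⟩
  · show ⟪c • u, g⟫_ℝ < 0
    rw [real_inner_smul_left]
    exact mul_neg_of_neg_of_pos hc0 hug0
  · show (‖c • u‖ ^ 2) • g - (2 * ⟪c • u, g⟫_ℝ) • c • u = y
    have hn : ‖c • u‖ ^ 2 = ‖y‖ := by rw [norm_smul, mul_pow, Real.norm_eq_abs, sq_abs, hc2]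
    have hs : 2 * (c * ⟪u, g⟫_ℝ) * c = ‖y‖ := by
      rw [← hc2, hu2]; ring
    rw [hn, real_inner_smul_left, smul_smul, hs, ← smul_sub, hu, sub_sub_cancel, hyh, smul_smul,
      mul_inv_cancel₀ hr0.ne', one_smul]

/-! ## Polar factorisation of Lebesgue measure and two radial integrals -/

/-- **Polar coordinates in `ℝ³`** (Mathlib's `measurePreserving_homeomorphUnitSphereProd`): if
`F(x) = a(x/|x|) b(|x|)` off the origin, then `∫ F dx = (∫_{S²} a dσ) (∫₀^∞ b(r) r² dr)`.
[folklore] -/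
theorem lintegral_eq_lintegral_toSphere_mul (F : V3 → ℝ≥0∞)
    (a : Metric.sphere (0 : V3) 1 → ℝ≥0∞) (b : ℝ → ℝ≥0∞) (ha : Measurable a) (hb : Measurable b)
    (hF : ∀ x : ({(0 : V3)}ᶜ : Set V3),
      F x = a (homeomorphUnitSphereProd V3 x).1 * b ‖(x : V3)‖) :
    ∫⁻ x, F x = (∫⁻ ω, a ω ∂(volume : Measure V3).toSphere) *
      ∫⁻ r in Ioi (0 : ℝ), b r * ENNReal.ofReal (r ^ 2) := by
  have hdim : Module.finrank ℝ V3 - 1 = 2 := by rw [finrank_euclideanSpace_fin]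
  have hmp := (volume : Measure V3).measurePreserving_homeomorphUnitSphereProd
  rw [hdim] at hmp
  calc ∫⁻ x, F x = ∫⁻ x : ({(0 : V3)}ᶜ : Set V3), F x ∂(Measure.comap Subtype.val volume) := by
        rw [lintegral_subtype_comap (measurableSet_singleton _).compl, restrict_compl_singleton]
    _ = ∫⁻ x : ({(0 : V3)}ᶜ : Set V3), (fun p : Metric.sphere (0 : V3) 1 × Ioi (0 : ℝ) =>
          a p.1 * b p.2) (homeomorphUnitSphereProd V3 x) ∂(Measure.comap Subtype.val volume) := by
        congr 1
        funext x
        simp only [hF x, homeomorphUnitSphereProd_apply_snd_coe]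
    _ = ∫⁻ p, a p.1 * b p.2 ∂((volume : Measure V3).toSphere.prod (Measure.volumeIoiPow 2)) :=
        hmp.lintegral_comp_emb (Homeomorph.measurableEmbedding _)
          (fun p : Metric.sphere (0 : V3) 1 × Ioi (0 : ℝ) => a p.1 * b p.2)
    _ = (∫⁻ ω, a ω ∂(volume : Measure V3).toSphere) * ∫⁻ r, b r ∂(Measure.volumeIoiPow 2) :=
        lintegral_prod_mul ha.aemeasurable (hb.comp measurable_subtype_coe).aemeasurable
    _ = _ := by
        congr 1
        rw [Measure.volumeIoiPow, lintegral_withDensity_eq_lintegral_mul _ (by fun_prop)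
            (g := fun r : Ioi (0 : ℝ) => b r) (hb.comp measurable_subtype_coe),
          ← lintegral_subtype_comap measurableSet_Ioi (fun r => b r * ENNReal.ofReal (r ^ 2))]
        congr 1
        funext r
        simp only [Pi.mul_apply, mul_comm]

/-- `∫₀^1 c rᵏ · r² dr = c / (k + 3)` as a Lebesgue integral over `(0, ∞)`. [folklore] -/
theorem lintegral_Ioi_indicator_pow_mul_sq (c : ℝ) (hc : 0 ≤ c) (k : ℕ) :
    ∫⁻ r in Ioi (0 : ℝ), (Iio (1 : ℝ)).indicator (fun r => ENNReal.ofReal (c * r ^ k)) r *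
        ENNReal.ofReal (r ^ 2) = ENNReal.ofReal (c / (k + 3)) := by
  have h : ∀ r : ℝ, (Iio (1 : ℝ)).indicator (fun r => ENNReal.ofReal (c * r ^ k)) r *
      ENNReal.ofReal (r ^ 2) =
        (Iio (1 : ℝ)).indicator (fun r => ENNReal.ofReal (c * r ^ (k + 2))) r := by
    intro r
    by_cases hr : r ∈ Iio (1 : ℝ)
    · rw [indicator_of_mem hr, indicator_of_mem hr, ← ENNReal.ofReal_mul' (by positivity), pow_add,
        mul_assoc]
    · rw [indicator_of_notMem hr, indicator_of_notMem hr, zero_mul]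
  simp_rw [h]
  rw [lintegral_indicator measurableSet_Iio, Measure.restrict_restrict measurableSet_Iio,
    Iio_inter_Ioi, Measure.restrict_congr_set Ioo_ae_eq_Ioc,
    ← ofReal_integral_eq_lintegral_ofReal
      ((intervalIntegral.intervalIntegrable_pow _).1.const_mul c),
    ← intervalIntegral.integral_of_le zero_le_one, intervalIntegral.integral_const_mul,
    integral_pow]
  · congr 1
    rw [one_pow, zero_pow (by positivity), sub_zero]
    push_cast
    ring
  · filter_upwards [ae_restrict_mem measurableSet_Ioc] with y hy
    have := hy.1.le
    positivity

/-! ## The isotropy identity -/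

/-- **ISOTROPY STUB (d = 3).** For a unit vector `g ∈ ℝ³` and a measurable `B ⊆ ℝ³`: the flux measure
`(−⟪ω, g⟫)₊ dσ(ω)` of the incoming hemisphere, pushed forward by the specular map `ω ↦ g − 2⟪ω, g⟫ ω`, charges `B`
with mass `¼ σ(B ∩ S²)` (`σ` = surface measure `sphereMeasure` = `volume.toSphere`). Classical: the differential
cross-section of hard spheres in three dimensions is constant, `ε²/4` per unit solid angle (CIP 1994 §3.1;
GST 2013 §2.1); in the angle `θ` between `−ω` and `g`, `cos θ sin θ dθ dφ = ¼ sin(2θ) d(2θ) dφ`. Route in Lean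
without spherical coordinates: polar factorisation `measurePreserving_homeomorphUnitSphereProd` and the change of
variables `x ↦ ‖x‖² g − 2⟪x, g⟫ x` on the half-space `⟪x, g⟫ > 0` (a diffeomorphism onto `ℝ³` minus a ray, with
`|det D| = 8‖x‖²⟪x, g⟫` and `‖·‖ ↦ ‖·‖²`). [cite: CIP1994, §3.1] -/
theorem stub_isotropy (g : V3) (hg : ‖g‖ = 1) {B : Set V3} (hB : MeasurableSet B) :
    ∫⁻ ω, {ω' : V3 | g - (2 * inner ℝ ω' g) • ω' ∈ B}.indicator (fun _ => (1 : ℝ≥0∞)) (ω : V3) *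
        ENNReal.ofReal (max (-inner ℝ (ω : V3) g) 0) ∂(sphereMeasure (E := V3)) =
      4⁻¹ * (sphereMeasure (E := V3)) {ω | (ω : V3) ∈ B} := by
  classical
  simp only [sphereMeasure]
  -- the data
  have hSm : MeasurableSet {ω : Metric.sphere (0 : V3) 1 | (ω : V3) ∈ B} :=
    measurable_subtype_coe hB
  have hTB : MeasurableSet {ω' : V3 | g - (2 * ⟪ω', g⟫_ℝ) • ω' ∈ B} :=
    hB.preimage (by fun_prop)
  set a : Metric.sphere (0 : V3) 1 → ℝ≥0∞ := fun ω =>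
    {ω' : V3 | g - (2 * ⟪ω', g⟫_ℝ) • ω' ∈ B}.indicator (fun _ => (1 : ℝ≥0∞)) (ω : V3) *
      ENNReal.ofReal (max (-⟪(ω : V3), g⟫_ℝ) 0) with ha
  have ham : Measurable a :=
    ((measurable_const.indicator hTB).comp measurable_subtype_coe).mul (by fun_prop)
  set Ψ : V3 → V3 := fun x => (‖x‖ ^ 2) • g - (2 * ⟪x, g⟫_ℝ) • x with hΨ
  set F' : V3 → (V3 →L[ℝ] V3) := fun x => (2 : ℝ) • (innerSL ℝ x).smulRight g
    - (2 : ℝ) • (innerSL ℝ g).smulRight x - (2 * ⟪x, g⟫_ℝ) • ContinuousLinearMap.id ℝ V3 with hF'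
  set H : Set V3 := {x | ⟪x, g⟫_ℝ < 0} with hH
  have hHm : MeasurableSet H := measurableSet_lt (by fun_prop) measurable_const
  set f : V3 → ℝ≥0∞ := fun y => {y' : V3 | ‖y'‖⁻¹ • y' ∈ B}.indicator (fun _ => (1 : ℝ≥0∞)) y *
    (Iio (1 : ℝ)).indicator (fun _ => (1 : ℝ≥0∞)) ‖y‖ with hf
  set b₁ : ℝ → ℝ≥0∞ := fun r =>
    (Iio (1 : ℝ)).indicator (fun r => ENNReal.ofReal (1 * r ^ 0)) r with hb₁
  set b₂ : ℝ → ℝ≥0∞ := fun r =>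
    (Iio (1 : ℝ)).indicator (fun r => ENNReal.ofReal (8 * r ^ 3)) r with hb₂
  have hb₁m : Measurable b₁ :=
    (by fun_prop : Measurable fun r : ℝ => ENNReal.ofReal (1 * r ^ 0)).indicator measurableSet_Iio
  have hb₂m : Measurable b₂ :=
    (by fun_prop : Measurable fun r : ℝ => ENNReal.ofReal (8 * r ^ 3)).indicator measurableSet_Iio
  -- change of variables
  have hcov := lintegral_image_eq_lintegral_abs_det_fderiv_mul volume hHm (f := Ψ) (f' := F')
    (fun x _ => (hasFDerivAt_specularExtension g x).hasFDerivWithinAt)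
    (injOn_specularExtension g hg) f
  -- the image has full measure
  have hspan : (ℝ ∙ g : Submodule ℝ V3) ≠ ⊤ := by
    intro htop
    have h1 : Module.finrank ℝ (ℝ ∙ g) ≤ 1 := (finrank_span_le_card ({g} : Set V3)).trans (by simp)
    rw [htop, finrank_top, finrank_euclideanSpace_fin] at h1
    omega
  have hnull : volume ((Ψ '' H)ᶜ) = 0 :=
    measure_mono_null (fun y hy => by_contra fun hy' => hy (mem_image_specularExtension g hg hy'))
      (Measure.addHaar_submodule volume (ℝ ∙ g) hspan)
  -- left-hand side in polar coordinates
  have hF₁ : ∀ x : ({(0 : V3)}ᶜ : Set V3), f x =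
      {ω : Metric.sphere (0 : V3) 1 | (ω : V3) ∈ B}.indicator 1 (homeomorphUnitSphereProd V3 x).1 *
        b₁ ‖(x : V3)‖ := by
    intro x
    simp only [hf, hb₁, indicator, mem_setOf_eq, homeomorphUnitSphereProd_apply_fst_coe,
      Pi.one_apply, one_mul, pow_zero, ENNReal.ofReal_one]
  have hL : ∫⁻ y in Ψ '' H, f y =
      (volume : Measure V3).toSphere {ω : Metric.sphere (0 : V3) 1 | (ω : V3) ∈ B} *
        ENNReal.ofReal (1 / ((0 : ℕ) + 3)) := by
    rw [Measure.restrict_congr_set (ae_eq_univ.2 hnull), Measure.restrict_univ,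
      lintegral_eq_lintegral_toSphere_mul f _ b₁ (measurable_one.indicator hSm) hb₁m hF₁,
      lintegral_indicator_one hSm, hb₁, lintegral_Ioi_indicator_pow_mul_sq 1 zero_le_one 0]
  -- right-hand side in polar coordinates
  have hF₂ : ∀ x : ({(0 : V3)}ᶜ : Set V3),
      H.indicator (fun x => ENNReal.ofReal |(F' x).det| * f (Ψ x)) x =
        a (homeomorphUnitSphereProd V3 x).1 * b₂ ‖(x : V3)‖ := by
    intro x
    have hx0 : (x : V3) ≠ 0 := x.2
    have hn0 : ‖(x : V3)‖ ≠ 0 := norm_ne_zero_iff.2 hx0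
    have hdet : (F' x).det = -8 * ⟪(x : V3), g⟫_ℝ * ‖(x : V3)‖ ^ 2 :=
      det_fderiv_specularExtension g x hg
    have hΨn : ‖Ψ x‖ = ‖(x : V3)‖ ^ 2 := norm_specularExtension g x hg
    have hΨu : (‖(x : V3)‖ ^ 2)⁻¹ • Ψ x =
        g - (2 * ⟪‖(x : V3)‖⁻¹ • (x : V3), g⟫_ℝ) • (‖(x : V3)‖⁻¹ • (x : V3)) := by
      rw [hΨ]
      simp only
      rw [smul_sub, smul_smul, smul_smul, real_inner_smul_left, inv_mul_cancel₀ (pow_ne_zero 2 hn0),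
        one_smul, smul_smul]
      congr 2
      field_simp
    have hxhat : ⟪‖(x : V3)‖⁻¹ • (x : V3), g⟫_ℝ = ‖(x : V3)‖⁻¹ * ⟪(x : V3), g⟫_ℝ :=
      real_inner_smul_left _ _ _
    simp only [indicator, hH, mem_setOf_eq, hf, ha, hb₂, hdet, hΨu, hΨn,
      homeomorphUnitSphereProd_apply_fst_coe, mem_Iio, sq_lt_one_iff₀ (norm_nonneg _), hxhat]
    by_cases hxg : ⟪(x : V3), g⟫_ℝ < 0
    · have h0 : 0 ≤ -(‖(x : V3)‖⁻¹ * ⟪(x : V3), g⟫_ℝ) :=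
        neg_nonneg.2 (mul_nonpos_of_nonneg_of_nonpos (inv_nonneg.2 (norm_nonneg _)) hxg.le)
      have habs : |-8 * ⟪(x : V3), g⟫_ℝ * ‖(x : V3)‖ ^ 2| =
          -(‖(x : V3)‖⁻¹ * ⟪(x : V3), g⟫_ℝ) * (8 * ‖(x : V3)‖ ^ 3) := by
        rw [abs_of_nonneg (by nlinarith [hxg, sq_nonneg ‖(x : V3)‖])]
        field_simp
      rw [if_pos hxg, max_eq_left h0, habs, ENNReal.ofReal_mul h0]
      split_ifs <;> ring
    · have h0 : -(‖(x : V3)‖⁻¹ * ⟪(x : V3), g⟫_ℝ) ≤ 0 :=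
        neg_nonpos.2 (mul_nonneg (inv_nonneg.2 (norm_nonneg _)) (not_lt.1 hxg))
      rw [if_neg hxg, max_eq_right h0, ENNReal.ofReal_zero, mul_zero, zero_mul]
  -- assemble: `σ(B ∩ S²) · ⅓ = I · 8/6`
  rw [hL, ← lintegral_indicator hHm, lintegral_eq_lintegral_toSphere_mul _ a b₂ ham hb₂m hF₂, hb₂,
    lintegral_Ioi_indicator_pow_mul_sq 8 (by norm_num) 3] at hcov
  have hSfin : (volume : Measure V3).toSphere {ω : Metric.sphere (0 : V3) 1 | (ω : V3) ∈ B} ≠ ⊤ :=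
    measure_ne_top _ _
  have hIfin : ∫⁻ ω, a ω ∂(volume : Measure V3).toSphere ≠ ⊤ := by
    intro htop
    rw [htop, ENNReal.top_mul (ENNReal.ofReal_ne_zero_iff.2 (by norm_num))] at hcov
    exact ENNReal.mul_ne_top hSfin ENNReal.ofReal_ne_top hcov
  refine (ENNReal.toReal_eq_toReal_iff' hIfin (ENNReal.mul_ne_top (by simp) hSfin)).1 ?_
  have h := congrArg ENNReal.toReal hcov
  rw [ENNReal.toReal_mul, ENNReal.toReal_mul, ENNReal.toReal_ofReal (by norm_num),
    ENNReal.toReal_ofReal (by norm_num)] at h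
  rw [ENNReal.toReal_mul, ENNReal.toReal_inv, ENNReal.toReal_ofNat]
  push_cast at h
  linarith

/-! ## Stub 4 — the dynamical core (OPEN): conditional flux law of the impact vector given the coarse past -/

/-- **CORE STUB (open; the crux's dynamical content in kernel form).** For every temperature `θ₀ > 0` there are
`C, p, σ₀ > 0` such that for `0 < σ < σ₀` some admissible mesh `ρ ∈ [σ, (√2πσ²)⁻¹]` makes the following hold for all
`τ > 0`, `n`, all large `N`, every flow `Φ`, particle `i`, measurable `S ⊆ ℝ³ × ℝ³` and every `𝒢`-event `E`
(`𝒢 = σ(coarsePastOf, nthPartnerOf)`): with `P` the global Gibbs law (activity 1, zero mean velocity, temperature `θ₀`),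
`W` = "`i` has ≥ `n+1` collisions in `(0, τ(N+1)^{-1/3}]`", `ω` the impact vector of the `n`-th collision of `i` and
`ĝ(z)` the normalised difference of the flight-start velocities of `i` and of its partner read off the coarse past
(a `𝒢`-measurable proxy of the incoming direction, equal to it on `Φ.good ∩ W` by `stub_preVel_eq_flightStart_vel`),
`|P(W ∩ {(ĝ, ω) ∈ S} ∩ E) − ∫_{W ∩ E} Flux_{ĝ(z)}(S_{ĝ(z)}) dP(z)| ≤ C σ^p`, where `Flux_g(U) = ∫_U (−⟪ω,g⟫)₊dω / ∫ (−⟪ω,g⟫)₊dω`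
is the normalised flux law of the incoming hemisphere of `g` and `S_g = {ω | (g, ω) ∈ S}`. In words: given the coarse
past, the impact vector of the `n`-th collision is flux-distributed (⟺ the impact parameter is uniform on the `ε`-disc)
up to `C σ^p` in `L¹(𝒢)`, uniformly in `n, τ`, for `N ≥ N₀(σ, ρ, τ, n)`. Open (lead-0 NOTES §B5: on the long-gap
event this is branch/dust equidistribution of the exact two-snapshot fibre). [folklore] -/
theorem stub_core : ∀ θ₀ : ℝ, 0 < θ₀ → ∃ C : ℝ, 0 < C ∧ ∃ p : ℝ, 0 < p ∧ ∃ σ₀ : ℝ, 0 < σ₀ ∧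
    ∀ σ : ℝ, 0 < σ → σ < σ₀ → ∃ ρ : ℝ, σ ≤ ρ ∧ ρ * (Real.sqrt 2 * Real.pi * σ ^ 2) ≤ 1 ∧
    ∀ τ : ℝ, 0 < τ → ∀ n : ℕ, ∃ N₀ : ℕ, ∀ N : ℕ, N₀ ≤ N →
    ∀ Φ : HardSphereFlow (Torus.geometry (Fin 3)) (hsDiameter σ N) (N + 1),
    ∀ (i : Fin (N + 1)) (S : Set (V3 × V3)), MeasurableSet S →
    let G : Geometry (Fin 3) T3 := Torus.geometry (Fin 3)
    let ε : ℝ := hsDiameter σ N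
    let w : ℝ := τ * ((N + 1 : ℕ) : ℝ) ^ (-(1 / 3 : ℝ))
    let q : T3 → (Fin 3 → ℤ) := Torus.coarseCell (ρ * ((N + 1 : ℕ) : ℝ) ^ (-(1 / 3 : ℝ)))
    let P : Measure (Config (N + 1) (Fin 3) T3) := localGibbsLaw σ (fun _ => 1) (fun _ => 0) (fun _ => θ₀) N Φ
    let W : Set (Config (N + 1) (Fin 3) T3) :=
      {z | n + 1 ≤ Set.ncard (collisionTimesOf G ε (fun t => Φ.flow t z) i ∩ Set.Ioc 0 w)}
    let gIn : Config (N + 1) (Fin 3) T3 → V3 := fun z =>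
      ‖((Φ.coarsePastOf q i n z).1 i).2 - ((Φ.coarsePastOf q i n z).2 (Φ.nthPartnerOf i n z)).2‖⁻¹ •
        (((Φ.coarsePastOf q i n z).1 i).2 - ((Φ.coarsePastOf q i n z).2 (Φ.nthPartnerOf i n z)).2)
    let flux : V3 → Set V3 → ℝ := fun g U =>
      ((∫⁻ ω, U.indicator (fun _ => (1 : ℝ≥0∞)) (ω : V3) * ENNReal.ofReal (max (-inner ℝ (ω : V3) g) 0)
          ∂(sphereMeasure (E := V3))) /
        (∫⁻ ω, ENNReal.ofReal (max (-inner ℝ (ω : V3) g) 0) ∂(sphereMeasure (E := V3)))).toReal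
    ∀ E : Set (Config (N + 1) (Fin 3) T3),
      MeasurableSet[MeasurableSpace.comap (fun z => (Φ.coarsePastOf q i n z, Φ.nthPartnerOf i n z))
        inferInstance] E →
      |(P (W ∩ {z | (gIn z, (Φ.nthRecordOf i n z).impactVec) ∈ S} ∩ E)).toReal -
          ∫ z in W ∩ E, flux (gIn z) {ω | (gIn z, ω) ∈ S} ∂P| ≤ C * σ ^ p := by
  sorry

/-! ## Composition (proved): the four stubs give the crux -/

/-- The set of pairs `(g, ω)` whose specular image `g − 2⟪ω, g⟫ω` lies in `B` is measurable. [folklore] -/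
theorem measurableSet_specular_preimage {B : Set V3} (hB : MeasurableSet B) :
    MeasurableSet {x : V3 × V3 | x.1 - (2 * inner ℝ x.2 x.1) • x.2 ∈ B} := by
  have hc : Continuous fun x : V3 × V3 => x.1 - (2 * inner ℝ x.2 x.1) • x.2 := by
    fun_prop
  exact hc.measurable hB

/-- The normalised flux law charges the specular preimage of `B` with the uniform probability of `B ∩ S²`
(from `stub_isotropy` applied to `B` and to `univ`). [folklore] -/
theorem flux_specular_eq_uniform (g : V3) (hg : ‖g‖ = 1) {B : Set V3} (hB : MeasurableSet B) :
    ((∫⁻ ω, {ω' : V3 | g - (2 * inner ℝ ω' g) • ω' ∈ B}.indicator (fun _ => (1 : ℝ≥0∞)) (ω : V3) *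
          ENNReal.ofReal (max (-inner ℝ (ω : V3) g) 0) ∂(sphereMeasure (E := V3))) /
        (∫⁻ ω, ENNReal.ofReal (max (-inner ℝ (ω : V3) g) 0) ∂(sphereMeasure (E := V3)))).toReal =
      (((sphereMeasure (E := V3)) Set.univ)⁻¹ * (sphereMeasure (E := V3)) {ω | (ω : V3) ∈ B}).toReal := by
  have hB' := stub_isotropy g hg hB
  have hU' : ∫⁻ ω, ENNReal.ofReal (max (-inner ℝ (ω : V3) g) 0) ∂(sphereMeasure (E := V3)) =
      4⁻¹ * (sphereMeasure (E := V3)) Set.univ := by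
    have hU := stub_isotropy g hg MeasurableSet.univ
    simpa using hU
  rw [hB', hU', ENNReal.mul_div_mul_left _ _ (by norm_num) (by norm_num), ENNReal.div_eq_inv_mul]

/-- The local Gibbs law does not charge the bad set of the flow (restated from
`Theorems.localGibbsLaw_compl_good` for the activity-1 law of the crux). [folklore] -/
theorem P_compl_good (σ θ₀ : ℝ) (N : ℕ)
    (Φ : HardSphereFlow (Torus.geometry (Fin 3)) (hsDiameter σ N) (N + 1)) :
    localGibbsLaw σ (fun _ => 1) (fun _ => 0) (fun _ => θ₀) N Φ Φ.goodᶜ = 0 :=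
  Summit.AtomisticToContinuum.HydrodynamicLimit.Theorems.localGibbsLaw_compl_good σ _ _ _ N Φ

/-- **COMPOSITION.** The four stubs imply the body of the crux at unit activity. [folklore] -/
theorem body_one_of_stubs (θ₀ : ℝ) (hθ : 0 < θ₀) : Body 1 θ₀ := by
  obtain ⟨C, hC, p, hp, σ₀, hσ₀, hcore⟩ := stub_core θ₀ hθ
  refine ⟨C, hC, p, hp, min σ₀ 2⁻¹, lt_min hσ₀ (by norm_num), fun σ hσ hσlt => ?_⟩
  have hσ₀' : σ < σ₀ := hσlt.trans_le (min_le_left _ _)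
  have hσ2 : σ < 2⁻¹ := hσlt.trans_le (min_le_right _ _)
  obtain ⟨ρ, hρ1, hρ2, hρ⟩ := hcore σ hσ hσ₀'
  refine ⟨ρ, hρ1, hρ2, fun τ hτ n => ?_⟩
  obtain ⟨N₀, hN₀⟩ := hρ τ hτ n
  refine ⟨N₀, fun N hN Φ i B hB => ?_⟩
  intro G ε w q P W A u E hE
  have hεpos : 0 < ε := hsDiameter_pos hσ N
  have hε2 : ε < 2⁻¹ := (hsDiameter_le hσ.le N).trans_lt hσ2
  -- the measurable set of pairs `(ĝ⁻, ω)` producing an outgoing direction in `B`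
  set SB : Set (V3 × V3) := {x : V3 × V3 | x.1 - (2 * inner ℝ x.2 x.1) • x.2 ∈ B} with hSB
  have hSBm : MeasurableSet SB := measurableSet_specular_preimage hB
  have hmain := hN₀ N hN Φ i SB hSBm E hE
  -- the 𝒢-measurable proxy of the incoming direction
  set gIn : Config (N + 1) (Fin 3) T3 → V3 := fun z =>
      ‖((Φ.coarsePastOf q i n z).1 i).2 - ((Φ.coarsePastOf q i n z).2 (Φ.nthPartnerOf i n z)).2‖⁻¹ •
        (((Φ.coarsePastOf q i n z).1 i).2 - ((Φ.coarsePastOf q i n z).2 (Φ.nthPartnerOf i n z)).2)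
    with hgIn
  -- on `good ∩ W`: the record is a contact record and its incoming direction is `gIn`
  have hgeom : ∀ z ∈ Φ.good, z ∈ W →
      ‖(Φ.nthRecordOf i n z).impactVec‖ = 1 ∧ (Φ.nthRecordOf i n z).inDir = gIn z ∧ ‖gIn z‖ = 1 ∧
        ((Φ.nthRecordOf i n z).outDir ∈ B ↔ (gIn z, (Φ.nthRecordOf i n z).impactVec) ∈ SB) := by
    intro z hz hzW
    obtain ⟨h1, h2, h3, h4⟩ := stub_record_geometry hεpos hε2 Φ i n w hz hzW
    have hpre := stub_preVel_eq_flightStart_vel hεpos hε2 Φ q i n w hz hzW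
    have hin : (Φ.nthRecordOf i n z).inDir = gIn z := by
      rw [hgIn, HardSphereCollisionRecord.inDir, hpre]
    refine ⟨h1, hin, by rw [← hin]; exact h2, ?_⟩
    rw [h4, hin, hSB]
    simp only [mem_setOf_eq]
  -- (a) the kick event and its `(ĝ, ω)`-form agree up to the null set `goodᶜ`
  have hnull : P Φ.goodᶜ = 0 := P_compl_good σ θ₀ N Φ
  have hA : P (W ∩ A ∩ E) = P (W ∩ {z | (gIn z, (Φ.nthRecordOf i n z).impactVec) ∈ SB} ∩ E) := by
    have hsd : symmDiff (W ∩ A) (W ∩ {z | (gIn z, (Φ.nthRecordOf i n z).impactVec) ∈ SB}) ⊆ Φ.goodᶜ := by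
      intro z hz hzg
      rcases hz with ⟨⟨hzW, hzA⟩, hnot⟩ | ⟨⟨hzW, hzA'⟩, hnot⟩
      · exact hnot ⟨hzW, ((hgeom z hzg hzW).2.2.2).1 hzA⟩
      · exact hnot ⟨hzW, ((hgeom z hzg hzW).2.2.2).2 hzA'⟩
    have := Summit.AtomisticToContinuum.HydrodynamicLimit.Theorems.measure_inter_congr_of_symmDiff_null
      P Φ.goodᶜ hnull hsd E
    rw [show W ∩ A ∩ E = E ∩ (W ∩ A) from by rw [Set.inter_comm],
      show W ∩ {z | (gIn z, (Φ.nthRecordOf i n z).impactVec) ∈ SB} ∩ E =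
        E ∩ (W ∩ {z | (gIn z, (Φ.nthRecordOf i n z).impactVec) ∈ SB}) from by rw [Set.inter_comm]]
    exact this
  -- (b) the compensator is `u · P(W ∩ E)`: the integrand is the constant `u` on `good ∩ W`
  have hWE_null : NullMeasurableSet (W ∩ E) P := by
    -- `W` is a.e. equal to its good version, `E` to a measurable version
    have hgood_ae : Φ.good =ᵐ[P] (Set.univ : Set (Config (N + 1) (Fin 3) T3)) := ae_eq_univ.2 hnull
    have hWm : MeasurableSet (Φ.good ∩ W) :=
      Summit.AtomisticToContinuum.HydrodynamicLimit.Theorems.measurableSet_good_inter_le_ncard_collisionTimesOf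
        Φ i (n + 1) w
    have hW_ae : (Φ.good ∩ W : Set _) =ᵐ[P] W := by
      have := hgood_ae.inter (ae_eq_refl W)
      rwa [Set.univ_inter] at this
    have hWnull : NullMeasurableSet W P := hWm.nullMeasurableSet.congr hW_ae
    obtain ⟨E', hE'm, hXE⟩ : ∃ E' : Set (Config (N + 1) (Fin 3) T3), MeasurableSet E' ∧
        ∀ X : Set (Config (N + 1) (Fin 3) T3), P (X ∩ E) = P (X ∩ E') := by
      classical
      have hf : Measurable (Φ.good.restrict fun z : Config (N + 1) (Fin 3) T3 =>
          (Φ.coarsePastOf q i n z, Φ.nthPartnerOf i n z)) :=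
        Summit.AtomisticToContinuum.HydrodynamicLimit.Theorems.measurable_coarsePastOf_nthPartnerOf_restrict
          Φ (ρ * ((N + 1 : ℕ) : ℝ) ^ (-(1 / 3 : ℝ))) i n
      let y₀ : ((Fin (N + 1) → (Fin 3 → ℤ) × EuclideanSpace ℝ (Fin 3)) ×
          (Fin (N + 1) → (Fin 3 → ℤ) × EuclideanSpace ℝ (Fin 3))) × Fin (N + 1) :=
        ((fun _ => (0, 0), fun _ => (0, 0)), i)
      obtain ⟨E', -, hE', hXE⟩ :=
        Summit.AtomisticToContinuum.HydrodynamicLimit.Theorems.exists_measurable_version_of_comap_event P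
          Φ.measurableSet_good hnull hf y₀ E hE
      exact ⟨E', hE', hXE⟩
    have hE_ae : E' =ᵐ[P] E := by
      refine (measure_symmDiff_eq_zero_iff).1 ?_
      rw [Set.symmDiff_def]
      refine measure_union_null ?_ ?_
      · rw [Set.sdiff_eq_compl_inter, ← hXE Eᶜ, Set.compl_inter_self, measure_empty]
      · rw [Set.sdiff_eq_compl_inter, hXE E'ᶜ, Set.compl_inter_self, measure_empty]
    exact hWnull.inter (hE'm.nullMeasurableSet.congr hE_ae)
  have hae : ∀ᵐ z ∂(P.restrict (W ∩ E)), z ∈ Φ.good ∧ z ∈ W := by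
    have h1 : ∀ᵐ z ∂(P.restrict (W ∩ E)), z ∈ W ∩ E := ae_restrict_mem₀ hWE_null
    have h2 : ∀ᵐ z ∂(P.restrict (W ∩ E)), z ∈ Φ.good :=
      ae_restrict_of_ae (ae_iff.2 hnull)
    filter_upwards [h1, h2] with z hz1 hz2
    exact ⟨hz2, hz1.1⟩
  have hflux : ∀ z ∈ Φ.good, z ∈ W →
      ((∫⁻ ω, {ω | (gIn z, ω) ∈ SB}.indicator (fun _ => (1 : ℝ≥0∞)) (ω : V3) *
            ENNReal.ofReal (max (-inner ℝ (ω : V3) (gIn z)) 0) ∂(sphereMeasure (E := V3))) /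
          (∫⁻ ω, ENNReal.ofReal (max (-inner ℝ (ω : V3) (gIn z)) 0) ∂(sphereMeasure (E := V3)))).toReal = u := by
    intro z hz hzW
    have hunit : ‖gIn z‖ = 1 := (hgeom z hz hzW).2.2.1
    have hset : {ω | (gIn z, ω) ∈ SB} = {ω' : V3 | gIn z - (2 * inner ℝ ω' (gIn z)) • ω' ∈ B} :=
      Set.ext fun _ => Iff.rfl
    rw [hset]
    exact flux_specular_eq_uniform (gIn z) hunit hB
  have hcomp : ∫ z in W ∩ E,
      ((∫⁻ ω, {ω | (gIn z, ω) ∈ SB}.indicator (fun _ => (1 : ℝ≥0∞)) (ω : V3) *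
            ENNReal.ofReal (max (-inner ℝ (ω : V3) (gIn z)) 0) ∂(sphereMeasure (E := V3))) /
          (∫⁻ ω, ENNReal.ofReal (max (-inner ℝ (ω : V3) (gIn z)) 0) ∂(sphereMeasure (E := V3)))).toReal ∂P =
      u * (P (W ∩ E)).toReal := by
    have hcongr : (fun z => ((∫⁻ ω, {ω | (gIn z, ω) ∈ SB}.indicator (fun _ => (1 : ℝ≥0∞)) (ω : V3) *
            ENNReal.ofReal (max (-inner ℝ (ω : V3) (gIn z)) 0) ∂(sphereMeasure (E := V3))) /
          (∫⁻ ω, ENNReal.ofReal (max (-inner ℝ (ω : V3) (gIn z)) 0) ∂(sphereMeasure (E := V3)))).toReal)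
        =ᵐ[P.restrict (W ∩ E)] fun _ => u := by
      filter_upwards [hae] with z hz
      exact hflux z hz.1 hz.2
    rw [integral_congr_ae hcongr, setIntegral_const, smul_eq_mul, mul_comm]
    rfl
  -- assemble
  have hmain' : |(P (W ∩ {z | (gIn z, (Φ.nthRecordOf i n z).impactVec) ∈ SB} ∩ E)).toReal -
      ∫ z in W ∩ E, ((∫⁻ ω, {ω | (gIn z, ω) ∈ SB}.indicator (fun _ => (1 : ℝ≥0∞)) (ω : V3) *
            ENNReal.ofReal (max (-inner ℝ (ω : V3) (gIn z)) 0) ∂(sphereMeasure (E := V3))) /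
          (∫⁻ ω, ENNReal.ofReal (max (-inner ℝ (ω : V3) (gIn z)) 0) ∂(sphereMeasure (E := V3)))).toReal ∂P|
        ≤ C * σ ^ p := hmain
  rw [hA, ← hcomp]
  exact hmain'

/-- **The crux**, from the four stubs: activity reduction (`body_iff_body_one`: a constant activity cancels from the
canonical density) applied to `body_one_of_stubs`. [folklore] -/
theorem OneFlightLayeredChaos_proof :
    Summit.AtomisticToContinuum.HydrodynamicLimit.Theses.OneFlightGossipEngine.OneFlightLayeredChaos :=
  oneFlightLayeredChaos_iff.2 fun _ θ₀ ha hθ => (body_iff_body_one ha.ne' θ₀).2 (body_one_of_stubs θ₀ hθ)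

end

end Summit.AtomisticToContinuum.HydrodynamicLimit.Cruxes.OneFlightLayeredChaos.Sketch
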